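import Summits.NavierStokesRegularity.NavierStokesRegularity.Theorems.SubcubicESSVelocityRescale
import Summits.NavierStokesRegularity.NavierStokesRegularity.Theorems.TypeICertificateLadderTargetStrainCubeRung
import Summits.NavierStokesRegularity.NavierStokesRegularity.Theorems.TypeICertificateLadderRungReynoldsOneTaoCover
import Summits.NavierStokesRegularity.NavierStokesRegularity.Theses.QuarterLogPincer
import HarnessLib

/-!
# `QuarterLogPincer.QuantBridge` (item stmt-NavierStokesRegularity-23632): a subexponential Tao
# function forces the super-logarithmic `L³` rate at every first blow-up

**Statement (the route decl, verbatim).** `QuantBridge := SubexpQuantESS → SuperlogTypeIRate`: if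
Tao's quantitative velocity bound in Tao's class (`ν = 1`, `‖u(t)‖₃ ≤ A` on `[0,T]`, `A ≥ 2` ⇒
`|u(t,x)| ≤ F(A) t^{-1/2}`) holds with a SUBEXPONENTIAL size function `F` (`F(A) ≤ e^{εA}` for
`A ≥ A₀(ε)`, every `ε > 0`), then every classical Leray–Hopf solution from a rapidly decaying datum
with no smooth extension past `T` (and the velocity Type-I rate, unused) beats every envelope
`C₁ + C₂ log(T/(T−t))` in `L³` at some `t < T`.

PROOF (the route's two-layer plan, child `QuantBridge`). Suppose `‖u(t)‖₃ ≤ C₁ + C₂ log(T/(T−t))` on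
`[0,T)`. For `t ∈ (T/2, T)` the closed slab `[0,t]` is Tao-class (`RungReynoldsOne.stub_taoCover`)
with `‖u(τ)‖₃ ≤ N(t) := max(|C₁| + |C₂| log(T/(T−t)), νA₀)` there; the velocity clause transported
to viscosity `ν` (`subcubicESS_norm_le_of_velocity_bound`, rescaling `w(s,x) = ν⁻¹u(s/ν,x)`) gives
`|u(t,x)| ≤ ν F(A) (νt)^{-1/2}` with `A = max(2, ν⁻¹N(t)) ≥ A₀`, so with `ε = ν/(4(|C₂|+1))`
(`εν⁻¹|C₂| ≤ 1/4`): `F(A) ≤ e^{εA} ≤ e^{E₀} (T/(T−t))^{1/4}`. Hence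
`√(T−t)|u(t,x)| ≤ M₀ (T−t)^{1/4} → 0`, in particular `≤ √ν` near `T`, and the in-tree Leray-rate rung
`DepletionLadder.StrainCube.hasSmoothExtensionPast_of_rate_lt` (constant `1`, `(√3+√6)/9 < 1`)
produces a smooth extension past `T` — contradiction.

HONEST FRAMING: a conditional bridge between two OPEN statements of route `QuarterLogPincer`
(`SubexpQuantESS`, stmt-23631, three exponentials below Tao 2019 Thm 1.2; `SuperlogTypeIRate`,
stmt-23361); nothing here asserts either, and Navier–Stokes regularity is NOT proved or claimed.
References: Tao, arXiv:1908.04958 Thm 1.2 (shape of the velocity clause); Tao 2013 footnote 3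
(viscosity rescaling); Leray 1934 (the rate). [folklore]
-/

noncomputable section

open Set Filter Topology MeasureTheory Function
open scoped ENNReal NNReal
open Literature.Analysis Literature.Analysis.FluidPDE

namespace Summit.NavierStokesRegularity.NavierStokesRegularity.Theorems

-- the problem directory repeats the summit name (`NavierStokesRegularity/NavierStokesRegularity`)
set_option linter.dupNamespace false

namespace QuantBridge

/-- **Log-bounded `L³` history + subexponential Tao function ⇒ the dimensionless rate tends to zero.**
Under the velocity clause with a subexponential `F`, a classical Leray–Hopf solution on `[0,T)` from a
rapidly decaying datum with `‖u(t)‖₃ ≤ C₁ + C₂ log(T/(T−t))` on `[0,T)` satisfies, for `t < T` close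
to `T`, `√(T−t) ‖u(t,x)‖ ≤ √ν` for all `x` (indeed `≤ M₀ (T−t)^{1/4}`). [folklore] -/
theorem eventually_rate_le {F : ℝ → ℝ}
    (hsub : ∀ ε : ℝ, 0 < ε → ∃ A₀ : ℝ, ∀ A : ℝ, A₀ ≤ A → F A ≤ Real.exp (ε * A))
    (hTao : ∀ (T A : ℝ) (u : ℝ → EuclideanSpace ℝ (Fin 3) → EuclideanSpace ℝ (Fin 3))
      (p : ℝ → EuclideanSpace ℝ (Fin 3) → ℝ),
      (IsClassicalNSSolutionOn (Icc 0 T) 1 0 u p ∧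
        ∀ n : ℕ, ∃ C : ℝ≥0, ∀ t ∈ Icc 0 T, eLpNorm (iteratedFDeriv ℝ n (u t)) 2 volume ≤ C) →
      (∀ t ∈ Icc 0 T, eLpNorm (u t) 3 volume ≤ ENNReal.ofReal A) → 2 ≤ A →
      ∀ t ∈ Ioc 0 T, ∀ x : EuclideanSpace ℝ (Fin 3), ‖u t x‖ ≤ F A * t ^ (-(1 / 2 : ℝ)))
    {ν T : ℝ} (hν : 0 < ν) (hT : 0 < T)
    {u : ℝ → EuclideanSpace ℝ (Fin 3) → EuclideanSpace ℝ (Fin 3)}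
    {p : ℝ → EuclideanSpace ℝ (Fin 3) → ℝ} (hcl : IsClassicalNSSolutionOn (Ico 0 T) ν 0 u p)
    (hLH : IsLerayHopfOn T ν 0 (u 0) u) (hdec : HasRapidSpatialDecay (u 0)) {C₁ C₂ : ℝ}
    (hlog : ∀ t ∈ Ico 0 T,
      eLpNorm (u t) 3 volume ≤ ENNReal.ofReal (C₁ + C₂ * Real.log (T / (T - t)))) :
    ∀ᶠ t in 𝓝[<] T, ∀ x, Real.sqrt (T - t) * ‖u t x‖ ≤ 1 * Real.sqrt ν := by
  -- ### constants
  have hν' : 0 ≤ ν⁻¹ := inv_nonneg.2 hν.le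
  set ε : ℝ := ν / (4 * (|C₂| + 1)) with hε
  have hC₂1 : 0 < |C₂| + 1 := by positivity
  have hε0 : 0 < ε := by positivity
  have hεC : ε * ν⁻¹ * |C₂| ≤ 1 / 4 := by
    have h1 : ε * ν⁻¹ * |C₂| = |C₂| / (4 * (|C₂| + 1)) := by
      rw [hε]
      field_simp
    rw [h1, div_le_iff₀ (by positivity)]
    nlinarith [abs_nonneg C₂]
  obtain ⟨A₀, hA₀⟩ := hsub ε hε0
  set E₀ : ℝ := ε * (2 + |A₀| + ν⁻¹ * |C₁|) with hE₀
  set M₀ : ℝ := ν * Real.exp E₀ * (ν * (T / 2)) ^ (-(1 / 2 : ℝ)) * T ^ (1 / 4 : ℝ) with hM₀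
  have hM₀0 : 0 < M₀ := by positivity
  set δ : ℝ := (Real.sqrt ν / M₀) ^ (4 : ℕ) with hδ
  have hδ0 : 0 < δ := by positivity
  set η : ℝ := min (T / 2) δ with hη
  have hη0 : 0 < η := lt_min (by positivity) hδ0
  have hηT : η ≤ T / 2 := min_le_left _ _
  have hηδ : η ≤ δ := min_le_right _ _
  -- ### the bound on `(T - η, T)`
  filter_upwards [Ioo_mem_nhdsLT (show T - η < T by linarith)] with t ht
  intro x
  rw [one_mul]
  have ht0 : 0 < t := by linarith [ht.1]
  have htT2 : T / 2 ≤ t := by linarith [ht.1]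
  have htT : t < T := ht.2
  have hTt : 0 < T - t := sub_pos.2 htT
  have hTtδ : T - t ≤ δ := by linarith [ht.1]
  set L : ℝ := Real.log (T / (T - t)) with hL
  have hL0 : 0 ≤ L := Real.log_nonneg ((one_le_div hTt).2 (by linarith))
  -- Tao-class cover of `[0, t]`
  obtain ⟨q, hclq, hHk, -, -⟩ := RungReynoldsOne.stub_taoCover hν hT hcl hLH hdec (T' := t) ⟨ht0, htT⟩
  -- the `L³` bound on `[0, t]`
  set N : ℝ := max (|C₁| + |C₂| * L) (ν * A₀) with hN
  have hNb : ∀ τ ∈ Icc 0 t, eLpNorm (u τ) 3 volume ≤ ENNReal.ofReal N := by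
    intro τ hτ
    have hTτ : 0 < T - τ := by linarith [hτ.2]
    refine (hlog τ ⟨hτ.1, hτ.2.trans_lt htT⟩).trans (ENNReal.ofReal_le_ofReal ?_)
    have hLτ0 : 0 ≤ Real.log (T / (T - τ)) :=
      Real.log_nonneg ((one_le_div hTτ).2 (by linarith [hτ.1]))
    have hLτ : Real.log (T / (T - τ)) ≤ L :=
      Real.log_le_log (div_pos hT hTτ) (div_le_div_of_nonneg_left hT.le hTt (by linarith [hτ.2]))
    calc C₁ + C₂ * Real.log (T / (T - τ))
        ≤ |C₁| + |C₂| * Real.log (T / (T - τ)) := by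
          refine add_le_add (le_abs_self _) ?_
          calc C₂ * Real.log (T / (T - τ)) ≤ |C₂ * Real.log (T / (T - τ))| := le_abs_self _
            _ = |C₂| * Real.log (T / (T - τ)) := by rw [abs_mul, abs_of_nonneg hLτ0]
      _ ≤ |C₁| + |C₂| * L := by gcongr
      _ ≤ N := le_max_left _ _
  -- the velocity clause at viscosity `ν`, read at time `t`
  have hvel := subcubicESS_norm_le_of_velocity_bound hTao hν ht0 hclq hHk hNb t ⟨ht0, le_rfl⟩ x
  set A : ℝ := max 2 (ν⁻¹ * N) with hA
  have hA₀A : A₀ ≤ A := by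
    have h1 : ν⁻¹ * (ν * A₀) ≤ ν⁻¹ * N := mul_le_mul_of_nonneg_left (le_max_right _ _) hν'
    rw [← mul_assoc, inv_mul_cancel₀ hν.ne', one_mul] at h1
    exact h1.trans (le_max_right _ _)
  have hFA : F A ≤ Real.exp (ε * A) := hA₀ A hA₀A
  -- `A ≤ 2 + |A₀| + ν⁻¹|C₁| + ν⁻¹|C₂| L`
  have hN0 : 0 ≤ |C₁| + |C₂| * L := by positivity
  have hNle : N ≤ |C₁| + |C₂| * L + ν * |A₀| := by
    refine max_le (le_add_of_nonneg_right (by positivity)) ?_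
    calc ν * A₀ ≤ ν * |A₀| := mul_le_mul_of_nonneg_left (le_abs_self _) hν.le
      _ ≤ |C₁| + |C₂| * L + ν * |A₀| := le_add_of_nonneg_left hN0
  have hAle : A ≤ 2 + |A₀| + ν⁻¹ * |C₁| + ν⁻¹ * |C₂| * L := by
    have hνN : 0 ≤ ν⁻¹ * N := mul_nonneg hν' (hN0.trans (le_max_left _ _))
    have h2 : ν⁻¹ * N ≤ |A₀| + ν⁻¹ * |C₁| + ν⁻¹ * |C₂| * L := by
      calc ν⁻¹ * N ≤ ν⁻¹ * (|C₁| + |C₂| * L + ν * |A₀|) := mul_le_mul_of_nonneg_left hNle hν'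
        _ = |A₀| + ν⁻¹ * |C₁| + ν⁻¹ * |C₂| * L := by
            field_simp
            ring
    have h3 : 0 ≤ |A₀| + ν⁻¹ * |C₁| + ν⁻¹ * |C₂| * L := by positivity
    refine max_le ?_ ?_
    · linarith
    · linarith
  have hεA : ε * A ≤ E₀ + L / 4 := by
    calc ε * A ≤ ε * (2 + |A₀| + ν⁻¹ * |C₁| + ν⁻¹ * |C₂| * L) :=
          mul_le_mul_of_nonneg_left hAle hε0.le
      _ = E₀ + (ε * ν⁻¹ * |C₂|) * L := by rw [hE₀]; ring
      _ ≤ E₀ + (1 / 4) * L := by gcongr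
      _ = E₀ + L / 4 := by ring
  have hexpA : Real.exp (ε * A) ≤ Real.exp E₀ * (T / (T - t)) ^ (1 / 4 : ℝ) := by
    calc Real.exp (ε * A) ≤ Real.exp (E₀ + L / 4) := Real.exp_le_exp.2 hεA
      _ = Real.exp E₀ * Real.exp (L / 4) := Real.exp_add _ _
      _ = Real.exp E₀ * (T / (T - t)) ^ (1 / 4 : ℝ) := by
          rw [Real.rpow_def_of_pos (div_pos hT hTt), hL]
          congr 2
          ring
  have hFle : F A ≤ Real.exp E₀ * (T / (T - t)) ^ (1 / 4 : ℝ) := hFA.trans hexpA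
  -- the pointwise bound at time `t`
  have hrt : 0 ≤ (ν * t) ^ (-(1 / 2 : ℝ)) := Real.rpow_nonneg (by positivity) _
  have hrt' : (ν * t) ^ (-(1 / 2 : ℝ)) ≤ (ν * (T / 2)) ^ (-(1 / 2 : ℝ)) :=
    Real.rpow_le_rpow_of_nonpos (by positivity) (by nlinarith) (by norm_num)
  have hu : ‖u t x‖ ≤ ν * (Real.exp E₀ * (T / (T - t)) ^ (1 / 4 : ℝ)) *
      (ν * (T / 2)) ^ (-(1 / 2 : ℝ)) := by
    calc ‖u t x‖ ≤ ν * F A * (ν * t) ^ (-(1 / 2 : ℝ)) := hvel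
      _ ≤ ν * (Real.exp E₀ * (T / (T - t)) ^ (1 / 4 : ℝ)) * (ν * t) ^ (-(1 / 2 : ℝ)) := by
          gcongr
      _ ≤ ν * (Real.exp E₀ * (T / (T - t)) ^ (1 / 4 : ℝ)) * (ν * (T / 2)) ^ (-(1 / 2 : ℝ)) := by
          gcongr
  -- `√(T−t) (T/(T−t))^{1/4} = T^{1/4} (T−t)^{1/4}`
  have hsplit : Real.sqrt (T - t) * (T / (T - t)) ^ (1 / 4 : ℝ) =
      T ^ (1 / 4 : ℝ) * (T - t) ^ (1 / 4 : ℝ) := by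
    have h14 : 0 < (T - t) ^ (1 / 4 : ℝ) := Real.rpow_pos_of_pos hTt _
    rw [Real.div_rpow hT.le hTt.le, Real.sqrt_eq_rpow,
      show (T - t) ^ (1 / 2 : ℝ) = (T - t) ^ (1 / 4 : ℝ) * (T - t) ^ (1 / 4 : ℝ) by
        rw [← Real.rpow_add hTt]; norm_num]
    field_simp
  -- `(T−t)^{1/4} ≤ √ν / M₀`
  have hquart : (T - t) ^ (1 / 4 : ℝ) ≤ Real.sqrt ν / M₀ := by
    calc (T - t) ^ (1 / 4 : ℝ) ≤ δ ^ (1 / 4 : ℝ) := Real.rpow_le_rpow hTt.le hTtδ (by norm_num)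
      _ = Real.sqrt ν / M₀ := by
          rw [hδ, ← Real.rpow_natCast, ← Real.rpow_mul (by positivity)]
          norm_num
  -- assemble
  calc Real.sqrt (T - t) * ‖u t x‖
      ≤ Real.sqrt (T - t) * (ν * (Real.exp E₀ * (T / (T - t)) ^ (1 / 4 : ℝ)) *
          (ν * (T / 2)) ^ (-(1 / 2 : ℝ))) :=
        mul_le_mul_of_nonneg_left hu (Real.sqrt_nonneg _)
    _ = M₀ * (T - t) ^ (1 / 4 : ℝ) := by
        have : Real.sqrt (T - t) * (ν * (Real.exp E₀ * (T / (T - t)) ^ (1 / 4 : ℝ)) *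
            (ν * (T / 2)) ^ (-(1 / 2 : ℝ))) =
            ν * Real.exp E₀ * (ν * (T / 2)) ^ (-(1 / 2 : ℝ)) *
              (Real.sqrt (T - t) * (T / (T - t)) ^ (1 / 4 : ℝ)) := by ring
        rw [this, hsplit, hM₀]
        ring
    _ ≤ M₀ * (Real.sqrt ν / M₀) := mul_le_mul_of_nonneg_left hquart hM₀0.le
    _ = Real.sqrt ν := by field_simp

/-- **Item stmt-NavierStokesRegularity-23632** (`QuarterLogPincer.QuantBridge`):
`SubexpQuantESS → SuperlogTypeIRate`. By contradiction: a log-bounded `L³` history and the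
subexponential velocity clause make the dimensionless rate `√(T−t)‖u(t)‖_∞` eventually `≤ √ν`
(`eventually_rate_le`), and the Leray-rate rung `hasSmoothExtensionPast_of_rate_lt` (constant `1`,
`(√3+√6)/9 < 1`) extends the solution past `T`, against `¬ HasSmoothExtensionPast`. The Type-I
hypothesis is not used. NOT a regularity claim: both sides of the bridge are open. [folklore] -/
theorem quantBridge_proof :
    Summit.NavierStokesRegularity.NavierStokesRegularity.Theses.QuarterLogPincer.QuantBridge := by
  unfold Summit.NavierStokesRegularity.NavierStokesRegularity.Theses.QuarterLogPincer.QuantBridge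
    Summit.NavierStokesRegularity.NavierStokesRegularity.Theses.QuarterLogPincer.SubexpQuantESS
    Summit.NavierStokesRegularity.NavierStokesRegularity.Theses.QuarterLogPincer.SuperlogTypeIRate
  rintro ⟨F, hsub, hTao⟩ ν T hν hT u p hcl hLH hdec hnext _hI C₁ C₂
  by_contra hcon
  have hcon' : ∀ t ∈ Ico 0 T,
      eLpNorm (u t) 3 volume ≤ ENNReal.ofReal (C₁ + C₂ * Real.log (T / (T - t))) :=
    fun t ht => not_lt.1 fun hlt => hcon ⟨t, ht, hlt⟩
  have hrate := eventually_rate_le hsub hTao hν hT hcl hLH hdec hcon'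
  have hκ : (Real.sqrt 3 + Real.sqrt 6) / 9 * 1 < 1 := by
    rw [mul_one]
    exact DepletionLadder.StrainCube.depletion_constant_lt_half.trans (by norm_num)
  exact hnext (DepletionLadder.StrainCube.hasSmoothExtensionPast_of_rate_lt hν hT one_pos hκ hcl
    hLH hdec hrate)

end QuantBridge

end Summit.NavierStokesRegularity.NavierStokesRegularity.Theorems

end
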